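import Mathlib
import Summits.Ventures.PercRepro2.TypedSepThreeSupport
import Summits.Ventures.PercRepro2.TypedSepTwoBStates

/-!
# The typed (SEP-2) zero, II (a₃ on the b-side): the split and the states of the support (blind
cell PercRepro2, p3 g6, 2026-08-25; `proofs/P3-BRIDGE.md` §11.22)

`Split2` : the roots `a₁, a₂` are the doors separating the o-side `WO ∋ o` from the b-side
`WB ∋ a₃, b`.  The b-side state is `SepThree.bSt`; the o-side state `oSt2` records `a₁~o`, `a₂~o`,
`a₁~a₂` inside the o-side.  The two-door closure lemmas give the seven coordinates and
`st_eq_sep2St`.  Own work; standard axioms.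
-/

namespace Summit.Ventures.PercRepro2

open UnionCluster

namespace CovForm

namespace SepTwo

open OneTyped TypedA3 Untouched TypedFactor Separated RootBridge SepThree

section Support

open Classical

variable {V : Type*} {E : Type*} [Fintype E] [DecidableEq E]
variable (ends : E → Sym2 V) (o a₁ a₂ a₃ b : V)

/-- **The (SEP-2) split with `a₃` on the b-side**: the roots `a₁, a₂` separate the o-side
`WO ∋ o` from the b-side `WB ∋ a₃, b` in the support `z ∪ F`. -/
structure Split2 (WO WB : Set V) (F : Finset E) (z : Config E) : Prop where
  split : ∀ e, zF F z e = true → e ∈ within ends WO ∨ e ∈ within ends WB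
  cap : ∀ t, t ∈ WO → t ∈ WB → t = a₁ ∨ t = a₂
  noloop : ∀ e ∈ F, ¬ (e ∈ within ends WO ∧ e ∈ within ends WB)
  oO : o ∈ WO
  a1O : a₁ ∈ WO
  a1B : a₁ ∈ WB
  a2O : a₂ ∈ WO
  a2B : a₂ ∈ WB
  a3B : a₃ ∈ WB
  bB : b ∈ WB
  o1 : o ≠ a₁
  o2 : o ≠ a₂
  a31 : a₃ ≠ a₁
  a32 : a₃ ≠ a₂
  b1 : b ≠ a₁
  b2 : b ≠ a₂

/-- The o-side state `(l, h, X)` of a configuration: `a₁ ~ o`, `a₂ ~ o`, `a₁ ~ a₂` inside `WO`. -/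
noncomputable def oSt2 (WO : Set V) (x : Config E) : OSt :=
  (decide (Conn ends (withinRestr ends WO x) a₁ o), decide (Conn ends (withinRestr ends WO x) a₂ o),
    decide (Conn ends (withinRestr ends WO x) a₁ a₂))

variable {ends o a₁ a₂ a₃ b}

omit [Fintype E] [DecidableEq E] in
/-- The o-side state of any configuration is valid (transitivity inside `WO`). -/
lemma validO_oSt2 (WO : Set V) (x : Config E) : ValidO (oSt2 ends o a₁ a₂ WO x) = true := by
  rw [validO_iff]
  simp only [oSt2, decide_eq_true_eq]
  exact ⟨fun h => conn_trans h.1 (conn_symm h.2), fun h => conn_trans (conn_symm h.2) h.1,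
    fun h => conn_trans h.2 h.1⟩

variable {WO WB : Set V} {F : Finset E} {z : Config E}

omit [Fintype E] in
/-- A configuration below `z ∪ F` has its open edges within a side. -/
lemma split_of_le (h : Split2 ends o a₁ a₂ a₃ b WO WB F z) {x : Config E} (hx : x ≤ zF F z) :
    ∀ e, x e = true → e ∈ within ends WO ∨ e ∈ within ends WB := fun e he =>
  h.split e (by have := hx e; rw [he] at this; exact Bool.eq_true_of_true_le this)

/-! ### The seven coordinates -/

section Coords

variable (h : Split2 ends o a₁ a₂ a₃ b WO WB F z) {x : Config E}
  (hsp : ∀ e, x e = true → e ∈ within ends WO ∨ e ∈ within ends WB)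

omit [Fintype E] [DecidableEq E] in
include hsp in
/-- The split with the roles of the sides exchanged. -/
lemma hsp' : ∀ e, x e = true → e ∈ within ends WB ∨ e ∈ within ends WO := fun e he =>
  (hsp e he).symm

omit [Fintype E] in
include h in
/-- The doors from the b-side. -/
lemma cap' : ∀ t, t ∈ WB → t ∈ WO → t = a₁ ∨ t = a₂ := fun t h1 h2 => h.cap t h2 h1

omit [Fintype E] in
include h hsp in
/-- `a₂ ~ a₁ = X ∨ h₁₂`. -/
lemma conn_a2a1 : Conn ends x a₂ a₁ ↔
    Conn ends (withinRestr ends WO x) a₁ a₂ ∨ Conn ends (withinRestr ends WB x) a₂ a₁ := by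
  have hd := conn_doors ends hsp h.cap h.a1O h.a1B (s₂ := a₂) (x := x)
  constructor
  · intro hc
    rcases hd.1 (conn_symm hc) with hO | hB
    · exact Or.inl hO
    · exact Or.inr (conn_symm hB)
  · rintro (hO | hB)
    · exact conn_symm (hd.2 (Or.inl hO))
    · exact conn_symm (hd.2 (Or.inr (conn_symm hB)))

omit [Fintype E] in
include h hsp in
/-- `a₁ ~ a₂` globally, in the door form. -/
lemma conn_a1a2 : Conn ends x a₁ a₂ ↔
    Conn ends (withinRestr ends WO x) a₁ a₂ ∨ Conn ends (withinRestr ends WB x) a₂ a₁ := by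
  rw [← conn_a2a1 h hsp]
  exact ⟨conn_symm, conn_symm⟩

omit [Fintype E] in
include h hsp in
/-- `a₁ ~ a₃ = Y ∨ (D ∧ (h₃₂ ∨ (h₁₂ ∧ Y)))`. -/
lemma conn_a1a3 : Conn ends x a₁ a₃ ↔
    Conn ends (withinRestr ends WB x) a₁ a₃ ∨
      ((Conn ends (withinRestr ends WO x) a₁ a₂ ∨ Conn ends (withinRestr ends WB x) a₂ a₁) ∧
        (Conn ends (withinRestr ends WB x) a₂ a₃ ∨
          (Conn ends (withinRestr ends WB x) a₂ a₁ ∧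
            Conn ends (withinRestr ends WB x) a₁ a₃))) := by
  have hin := conn_inside ends (hsp' hsp) (cap' h) h.a1B h.a1O h.a2B h.a2O h.a1B h.a3B
  rw [conn_a1a2 h hsp] at hin
  rw [hin]
  constructor
  · rintro (hc | ⟨hD, ⟨_, h23⟩ | ⟨h12, h13⟩⟩)
    · exact Or.inl hc
    · exact Or.inr ⟨hD, Or.inl h23⟩
    · exact Or.inr ⟨hD, Or.inr ⟨conn_symm h12, h13⟩⟩
  · rintro (hc | ⟨hD, h23 | ⟨h21, h13⟩⟩)
    · exact Or.inl hc
    · exact Or.inr ⟨hD, Or.inl ⟨conn_refl _ _ _, h23⟩⟩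
    · exact Or.inr ⟨hD, Or.inr ⟨conn_symm h21, h13⟩⟩

omit [Fintype E] in
include h hsp in
/-- `a₂ ~ a₃ = h₃₂ ∨ (D ∧ ((h₁₂ ∧ h₃₂) ∨ Y))`. -/
lemma conn_a2a3 : Conn ends x a₂ a₃ ↔
    Conn ends (withinRestr ends WB x) a₂ a₃ ∨
      ((Conn ends (withinRestr ends WO x) a₁ a₂ ∨ Conn ends (withinRestr ends WB x) a₂ a₁) ∧
        ((Conn ends (withinRestr ends WB x) a₂ a₁ ∧ Conn ends (withinRestr ends WB x) a₂ a₃) ∨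
          Conn ends (withinRestr ends WB x) a₁ a₃)) := by
  have hin := conn_inside ends (hsp' hsp) (cap' h) h.a1B h.a1O h.a2B h.a2O h.a2B h.a3B
  rw [conn_a1a2 h hsp] at hin
  rw [hin]
  constructor
  · rintro (hc | ⟨hD, ⟨h21, h23⟩ | ⟨_, h13⟩⟩)
    · exact Or.inl hc
    · exact Or.inr ⟨hD, Or.inl ⟨h21, h23⟩⟩
    · exact Or.inr ⟨hD, Or.inr h13⟩
  · rintro (hc | ⟨hD, ⟨h21, h23⟩ | h13⟩)
    · exact Or.inl hc
    · exact Or.inr ⟨hD, Or.inl ⟨h21, h23⟩⟩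
    · exact Or.inr ⟨hD, Or.inr ⟨conn_refl _ _ _, h13⟩⟩

omit [Fintype E] in
include h hsp in
/-- `a₁ ~ b = b₁ ∨ (D ∧ (b₂ ∨ (h₁₂ ∧ b₁)))`. -/
lemma conn_a1b : Conn ends x a₁ b ↔
    Conn ends (withinRestr ends WB x) a₁ b ∨
      ((Conn ends (withinRestr ends WO x) a₁ a₂ ∨ Conn ends (withinRestr ends WB x) a₂ a₁) ∧
        (Conn ends (withinRestr ends WB x) a₂ b ∨
          (Conn ends (withinRestr ends WB x) a₂ a₁ ∧ Conn ends (withinRestr ends WB x) a₁ b))) := by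
  have hin := conn_inside ends (hsp' hsp) (cap' h) h.a1B h.a1O h.a2B h.a2O h.a1B h.bB
  rw [conn_a1a2 h hsp] at hin
  rw [hin]
  constructor
  · rintro (hc | ⟨hD, ⟨_, h2b⟩ | ⟨h12, h1b⟩⟩)
    · exact Or.inl hc
    · exact Or.inr ⟨hD, Or.inl h2b⟩
    · exact Or.inr ⟨hD, Or.inr ⟨conn_symm h12, h1b⟩⟩
  · rintro (hc | ⟨hD, h2b | ⟨h21, h1b⟩⟩)
    · exact Or.inl hc
    · exact Or.inr ⟨hD, Or.inl ⟨conn_refl _ _ _, h2b⟩⟩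
    · exact Or.inr ⟨hD, Or.inr ⟨conn_symm h21, h1b⟩⟩

omit [Fintype E] in
include h hsp in
/-- `a₂ ~ b = b₂ ∨ (D ∧ ((h₁₂ ∧ b₂) ∨ b₁))`. -/
lemma conn_a2b : Conn ends x a₂ b ↔
    Conn ends (withinRestr ends WB x) a₂ b ∨
      ((Conn ends (withinRestr ends WO x) a₁ a₂ ∨ Conn ends (withinRestr ends WB x) a₂ a₁) ∧
        ((Conn ends (withinRestr ends WB x) a₂ a₁ ∧ Conn ends (withinRestr ends WB x) a₂ b) ∨
          Conn ends (withinRestr ends WB x) a₁ b)) := by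
  have hin := conn_inside ends (hsp' hsp) (cap' h) h.a1B h.a1O h.a2B h.a2O h.a2B h.bB
  rw [conn_a1a2 h hsp] at hin
  rw [hin]
  constructor
  · rintro (hc | ⟨hD, ⟨h21, h2b⟩ | ⟨_, h1b⟩⟩)
    · exact Or.inl hc
    · exact Or.inr ⟨hD, Or.inl ⟨h21, h2b⟩⟩
    · exact Or.inr ⟨hD, Or.inr h1b⟩
  · rintro (hc | ⟨hD, ⟨h21, h2b⟩ | h1b⟩)
    · exact Or.inl hc
    · exact Or.inr ⟨hD, Or.inl ⟨h21, h2b⟩⟩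
    · exact Or.inr ⟨hD, Or.inr ⟨conn_refl _ _ _, h1b⟩⟩

omit [Fintype E] in
include h hsp in
/-- `a₁ ~ o = l ∨ (D ∧ (h ∨ (X ∧ l)))`. -/
lemma conn_a1o : Conn ends x a₁ o ↔
    Conn ends (withinRestr ends WO x) a₁ o ∨
      ((Conn ends (withinRestr ends WO x) a₁ a₂ ∨ Conn ends (withinRestr ends WB x) a₂ a₁) ∧
        (Conn ends (withinRestr ends WO x) a₂ o ∨
          (Conn ends (withinRestr ends WO x) a₁ a₂ ∧ Conn ends (withinRestr ends WO x) a₁ o))) := by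
  have hin := conn_inside ends hsp h.cap h.a1O h.a1B h.a2O h.a2B h.a1O h.oO
  rw [conn_a1a2 h hsp] at hin
  rw [hin]
  constructor
  · rintro (hc | ⟨hD, ⟨_, h2o⟩ | ⟨hX, h1o⟩⟩)
    · exact Or.inl hc
    · exact Or.inr ⟨hD, Or.inl h2o⟩
    · exact Or.inr ⟨hD, Or.inr ⟨hX, h1o⟩⟩
  · rintro (hc | ⟨hD, h2o | ⟨hX, h1o⟩⟩)
    · exact Or.inl hc
    · exact Or.inr ⟨hD, Or.inl ⟨conn_refl _ _ _, h2o⟩⟩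
    · exact Or.inr ⟨hD, Or.inr ⟨hX, h1o⟩⟩

omit [Fintype E] in
include h hsp in
/-- `a₂ ~ o = h ∨ (D ∧ ((X ∧ h) ∨ l))`. -/
lemma conn_a2o : Conn ends x a₂ o ↔
    Conn ends (withinRestr ends WO x) a₂ o ∨
      ((Conn ends (withinRestr ends WO x) a₁ a₂ ∨ Conn ends (withinRestr ends WB x) a₂ a₁) ∧
        ((Conn ends (withinRestr ends WO x) a₁ a₂ ∧ Conn ends (withinRestr ends WO x) a₂ o) ∨
          Conn ends (withinRestr ends WO x) a₁ o)) := by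
  have hin := conn_inside ends hsp h.cap h.a1O h.a1B h.a2O h.a2B h.a2O h.oO
  rw [conn_a1a2 h hsp] at hin
  rw [hin]
  constructor
  · rintro (hc | ⟨hD, ⟨h21, h2o⟩ | ⟨_, h1o⟩⟩)
    · exact Or.inl hc
    · exact Or.inr ⟨hD, Or.inl ⟨conn_symm h21, h2o⟩⟩
    · exact Or.inr ⟨hD, Or.inr h1o⟩
  · rintro (hc | ⟨hD, ⟨hX, h2o⟩ | h1o⟩)
    · exact Or.inl hc
    · exact Or.inr ⟨hD, Or.inl ⟨conn_symm hX, h2o⟩⟩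
    · exact Or.inr ⟨hD, Or.inr ⟨conn_refl _ _ _, h1o⟩⟩

end Coords

omit [Fintype E] in
/-- **The state of a copy of the support is the gluing of its side states.** -/
theorem st_eq_sep2St (h : Split2 ends o a₁ a₂ a₃ b WO WB F z) {x : Config E}
    (hx : x ≤ zF F z) :
    st ends o a₁ a₂ a₃ b x = glued2 (oSt2 ends o a₁ a₂ WO x) (bSt ends a₁ a₂ a₃ b WB x) := by
  have hsp := split_of_le h hx
  have e1 := conn_a2a1 h hsp
  have e2 := conn_a1o h hsp
  have e3 := conn_a2o h hsp
  have e4 := conn_a1b h hsp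
  have e5 := conn_a2b h hsp
  have e6 := conn_a1a3 h hsp
  have e7 := conn_a2a3 h hsp
  unfold st glued2 oSt2 bSt
  rw [decide_eq_decide.mpr e1, decide_eq_decide.mpr e2, decide_eq_decide.mpr e3,
    decide_eq_decide.mpr e4, decide_eq_decide.mpr e5, decide_eq_decide.mpr e6,
    decide_eq_decide.mpr e7]
  simp only [Bool.decide_or, Bool.decide_and]
  all_goals infer_instance

end Support

end SepTwo

end CovForm

end Summit.Ventures.PercRepro2
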